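import Summits.Ventures.PercRepro.ProfileThreeAverage

/-!
# PercRepro — THE ROW `q = 3` OF (Π): THE INDEPENDENT HALF, WITH THE «`u−2` COLOOPS ⊕ LINE» SETS ADDED — the theorem
(p10, gen 5; `proofs/P10-Q3-INDEP.md` §2; the definitions `fSets`, `badTriples`, `Indep3Plus`, the per-triple
inequality, the deletion identity of `fSets` and the injection of the bad triples are in `ProfileThreeAverage`)

`INDEP₃⁺`: on a simple matroid `M` and at a level `u ≥ 4`, `Σ_{B independent triple} d_B ≤ C(u,3) · (I_u + F_u)`,
`I_u` the independent `u`-sets and `F_u` the rank-`u` sets with exactly `u − 2` coloops.  Induction on `|E|`: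
`|E| ≤ u+2` has no demand, `|E| = u+3` is the identity level (`B ↦ E ∖ B` into the independent `u`-sets), and for
`|E| ≥ u+4` the averaged deletion step `(|E|−u)·D₃(M) ≤ Σ_z D₃(M∖z) + C(u,3)·#Bad` (`avg_step3`) together with
the induction hypothesis on the simple deletions, the identities `Σ_z I_u(M∖z) = (|E|−u)·I_u` and
`Σ_z F_u(M∖z) = |E|·F_u − Σ_{S∈F}|S|`, and `#Bad ≤ Σ_{S∈F}(|S|−u)` give `(|E|−u)·D₃(M) ≤ C(u,3)·(|E|−u)·(I_u + F_u)`.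

* `avg_step3` — the averaged deletion step with the bad-triple term;
* `indep3Plus_of_card_le`, `indep3Plus_of_card_eq` — the levels `|E| ≤ u+2` and `|E| = u+3`;
* **`indep3Plus_of_simple`** — `INDEP₃⁺` on every simple matroid, every `u ≥ 4`.
-/

open scoped Matroid

namespace PercRepro.Cogirth

open Finset ThmH Skew Shadow Profile

variable {α : Type} [DecidableEq α] {M : Matroid α} [M.Finite]

/-! ### The averaged deletion step and the theorem -/

/-- **The averaged deletion step** for the independent triples: on a simple matroid on `≥ u + 4` elements,
`(|E| − u) · D₃(M; u) ≤ Σ_{z ∈ E} D₃(M ∖ z; u) + C(u,3) · #Bad`. -/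
theorem avg_step3 (hs : Simple' M) {u : ℕ} (hu : 4 ≤ u) (hn : u + 4 ≤ (gr M).card) :
    ((gr M).card - u) * ∑ B ∈ indepSets M 3, demand M 3 u B ≤
      ∑ z ∈ gr M, ∑ B ∈ indepSets (M ＼ ({z} : Set α)) 3, demand (M ＼ ({z} : Set α)) 3 u B +
        u.choose 3 * (badTriples M u).card := by
  rw [mul_sum]
  have hper : ∀ B ∈ indepSets M 3, ((gr M).card - u) * demand M 3 u B ≤
      ∑ z ∈ gr M \ B, demand (M ＼ ({z} : Set α)) 3 u B + (if B ∈ badTriples M u then u.choose 3 else 0) := by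
    intro B hB
    by_cases hb : B ∈ badTriples M u
    · rw [if_pos hb, perTriple_bad hu hn hb]
    · rw [if_neg hb, add_zero]
      exact perTriple hs hu hn hB hb
  have hbadeq : (indepSets M 3).filter (fun B => B ∈ badTriples M u) = badTriples M u := by
    rw [filter_mem_eq_inter]
    exact inter_eq_right.2 (filter_subset _ _)
  calc ∑ B ∈ indepSets M 3, ((gr M).card - u) * demand M 3 u B
      ≤ ∑ B ∈ indepSets M 3, (∑ z ∈ gr M \ B, demand (M ＼ ({z} : Set α)) 3 u B +
          (if B ∈ badTriples M u then u.choose 3 else 0)) := sum_le_sum hper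
    _ = ∑ B ∈ indepSets M 3, ∑ z ∈ gr M \ B, demand (M ＼ ({z} : Set α)) 3 u B +
          u.choose 3 * (badTriples M u).card := by
        rw [sum_add_distrib, ← sum_filter, hbadeq, sum_const, smul_eq_mul, mul_comm]
    _ = ∑ z ∈ gr M, ∑ B ∈ (indepSets M 3).filter (fun B => z ∉ B),
          demand (M ＼ ({z} : Set α)) 3 u B + u.choose 3 * (badTriples M u).card := by
        congr 1
        apply sum_comm'
        intro B z
        rw [mem_sdiff, mem_filter]
        tauto
    _ = ∑ z ∈ gr M, ∑ B ∈ indepSets (M ＼ ({z} : Set α)) 3, demand (M ＼ ({z} : Set α)) 3 u B +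
          u.choose 3 * (badTriples M u).card := by
        congr 1
        apply sum_congr rfl
        intro z _
        rw [indepSets_delete_eq_filter]

/-- No demand when `|E| ≤ u + 2`: the complement of a triple has rank `< u`. -/
theorem indep3Plus_of_card_le {u : ℕ} (hu : 3 ≤ u) (hn : (gr M).card ≤ u + 2) : Indep3Plus M u := by
  unfold Indep3Plus
  have h0 : ∀ B ∈ indepSets M 3, demand M 3 u B = 0 := by
    intro B hB
    rw [demand3_eq_ite, if_neg]
    have h1 := rk_le_card (M := M) (gr M \ B)
    have h2 := card_sdiff_of_mem_indepSets_three hB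
    omega
  rw [sum_eq_zero h0]
  exact Nat.zero_le _

/-- The identity level `|E| = u + 3`: `d_B = C(u,3) · [E ∖ B independent]`, and `B ↦ E ∖ B` injects into the
independent `u`-sets. -/
theorem indep3Plus_of_card_eq {u : ℕ} (hu : 3 ≤ u) (hn : (gr M).card = u + 3) : Indep3Plus M u := by
  classical
  unfold Indep3Plus
  have hd : ∀ B ∈ indepSets M 3, demand M 3 u B =
      if gr M \ B ∈ indepSets M u then u.choose 3 else 0 := by
    intro B hB
    have hc : (gr M \ B).card = u := by rw [card_sdiff_of_mem_indepSets_three hB, hn]; rfl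
    have hle := rk_le_card (M := M) (gr M \ B)
    rw [demand3_eq_ite]
    by_cases hi : gr M \ B ∈ indepSets M u
    · rw [if_pos hi]
      have hr : rk M (gr M \ B) = u := by
        rw [rk_eq_card_of_indep (mem_indepSets.1 hi).2.2, hc]
      rw [if_pos (by omega), hr, Nat.choose_symm (by omega : 3 ≤ u)]
    · rw [if_neg hi, if_neg]
      intro hur
      apply hi
      rw [mem_indepSets]
      exact ⟨sdiff_subset, hc, indep_of_rk_eq_card (by omega)⟩
  rw [sum_congr rfl hd, ← sum_filter, sum_const, smul_eq_mul, mul_comm]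
  apply Nat.mul_le_mul_left
  calc ((indepSets M 3).filter (fun B => gr M \ B ∈ indepSets M u)).card ≤ (indepSets M u).card := by
        apply card_le_card_of_injOn (fun B => gr M \ B)
        · intro B hB
          rw [Finset.mem_coe, mem_filter] at hB
          rw [Finset.mem_coe]
          exact hB.2
        · intro B hB B' hB' h
          rw [Finset.mem_coe, mem_filter] at hB hB'
          have h1 : B ⊆ gr M := (mem_indepSets.1 hB.1).1
          have h2 : B' ⊆ gr M := (mem_indepSets.1 hB'.1).1
          simp only at h
          rw [← Finset.sdiff_sdiff_eq_self h1, ← Finset.sdiff_sdiff_eq_self h2, h]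
    _ ≤ (indepSets M u).card + (fSets M u).card := Nat.le_add_right _ _

/-- **`INDEP₃⁺` on every simple matroid** — strong induction on `|E|`. -/
theorem indep3Plus_of_simple_aux : ∀ (n : ℕ) (M : Matroid α) [M.Finite], (gr M).card = n → Simple' M →
    ∀ u : ℕ, 4 ≤ u → Indep3Plus M u := by
  intro n
  induction n using Nat.strong_induction_on with
  | _ n ih =>
    intro M _ hn hs u hu
    rcases Nat.lt_or_ge n (u + 3) with hsmall | hbig
    · exact indep3Plus_of_card_le (by omega) (by omega)
    rcases Nat.eq_or_lt_of_le hbig with heq | hgt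
    · exact indep3Plus_of_card_eq (by omega) (by omega)
    have hn4 : u + 4 ≤ (gr M).card := by omega
    have hstep := avg_step3 hs hu hn4
    have hih : ∀ z ∈ gr M, ∑ B ∈ indepSets (M ＼ ({z} : Set α)) 3, demand (M ＼ ({z} : Set α)) 3 u B ≤
        u.choose 3 * ((indepSets (M ＼ ({z} : Set α)) u).card + (fSets (M ＼ ({z} : Set α)) u).card) := by
      intro z hz
      have hcard : (gr (M ＼ ({z} : Set α))).card = n - 1 := by
        rw [gr_delete', card_erase_of_mem hz, hn]
      exact ih (n - 1) (by omega) (M ＼ ({z} : Set α)) hcard (simple'_delete hs z) u hu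
    have hsum := sum_le_sum hih
    rw [← mul_sum, sum_add_distrib] at hsum
    have hidI := sum_card_indepSets_delete_add (M := M) u
    have hidF := sum_card_fSets_delete_add (M := M) u
    have hbad := card_badTriples_le (M := M) hn4
    have hF : ∑ S ∈ fSets M u, (S.card - u) + u * (fSets M u).card = ∑ S ∈ fSets M u, S.card := by
      rw [card_eq_sum_ones, mul_sum, ← sum_add_distrib]
      apply sum_congr rfl
      intro S hS
      have := (mem_fSets.1 hS).2.2.1
      omega
    -- the linear bookkeeping, with the products as atoms
    have hkey : ∑ z ∈ gr M, (indepSets (M ＼ ({z} : Set α)) u).card +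
        ∑ z ∈ gr M, (fSets (M ＼ ({z} : Set α)) u).card + (badTriples M u).card ≤
        ((gr M).card - u) * ((indepSets M u).card + (fSets M u).card) := by
      rw [Nat.sub_mul, Nat.mul_add, Nat.mul_add]
      generalize ∑ z ∈ gr M, (indepSets (M ＼ ({z} : Set α)) u).card = P at hidI ⊢
      generalize ∑ z ∈ gr M, (fSets (M ＼ ({z} : Set α)) u).card = Q at hidF ⊢
      generalize ∑ S ∈ fSets M u, S.card = T at hidF hF ⊢
      generalize ∑ S ∈ fSets M u, (S.card - u) = T' at hbad hF ⊢
      generalize (badTriples M u).card = Bad at hbad ⊢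
      generalize hX : (indepSets M u).card = X at hidI ⊢
      generalize hY : (fSets M u).card = Y at hidF hF ⊢
      generalize hnn : (gr M).card = N at hidI hidF hn4 ⊢
      generalize u * X = uX at hidI ⊢
      generalize N * X = NX at hidI ⊢
      generalize u * Y = uY at hF ⊢
      generalize N * Y = NY at hidF ⊢
      omega
    have hfinal : ((gr M).card - u) * ∑ B ∈ indepSets M 3, demand M 3 u B ≤
        ((gr M).card - u) * (u.choose 3 * ((indepSets M u).card + (fSets M u).card)) := by
      calc ((gr M).card - u) * ∑ B ∈ indepSets M 3, demand M 3 u B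
          ≤ ∑ z ∈ gr M, ∑ B ∈ indepSets (M ＼ ({z} : Set α)) 3, demand (M ＼ ({z} : Set α)) 3 u B +
              u.choose 3 * (badTriples M u).card := hstep
        _ ≤ u.choose 3 * (∑ z ∈ gr M, (indepSets (M ＼ ({z} : Set α)) u).card +
              ∑ z ∈ gr M, (fSets (M ＼ ({z} : Set α)) u).card) + u.choose 3 * (badTriples M u).card :=
            Nat.add_le_add_right hsum _
        _ = u.choose 3 * (∑ z ∈ gr M, (indepSets (M ＼ ({z} : Set α)) u).card +
              ∑ z ∈ gr M, (fSets (M ＼ ({z} : Set α)) u).card + (badTriples M u).card) := by ring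
        _ ≤ u.choose 3 * (((gr M).card - u) * ((indepSets M u).card + (fSets M u).card)) :=
            Nat.mul_le_mul_left _ hkey
        _ = ((gr M).card - u) * (u.choose 3 * ((indepSets M u).card + (fSets M u).card)) := by ring
    exact Nat.le_of_mul_le_mul_left hfinal (by omega)

/-- **`INDEP₃⁺` on every simple matroid, every `u ≥ 4`** (one-matroid form): the demand of the independent
triples is at most `C(u,3)` times the number of independent `u`-sets plus the number of rank-`u` sets with
exactly `u − 2` coloops. -/
theorem indep3Plus_of_simple (hs : Simple' M) {u : ℕ} (hu : 4 ≤ u) : Indep3Plus M u :=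
  indep3Plus_of_simple_aux (gr M).card M rfl hs u hu

end PercRepro.Cogirth
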